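import Summits.CriticalPhenomena.PercolationContinuityZ3.Theorems.PercNearOneGluingNoHeavyLowerTailCubicThreePointTwoSumClosure
import Mathlib.Tactic.Ring
import Mathlib.Tactic.Linarith
import Mathlib.Tactic.Positivity
import HarnessLib

/-!
# `NoHeavyLowerTail` (stmt-CriticalPhenomena-4575) — 2-SUM CLOSURE of the sharp cubic row, II: the MIXED case (one sparse-type and one
# dense-type piece), hence the K3 invariant `{AG ≥ 0, max(Ha,Hb) ≥ 0}` is closed under 2-sums along `{terminal, Steiner vertex}` outright

Support file (prover prim-gen-kcluster gen 28; `--supports stmt-CriticalPhenomena-4575`; memo run/shared/lean/prim/prim-gen-kcluster/KCLUSTER-gen28.md §7).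
Companion of `…CubicThreePointTwoSumClosure` (the 2-sum `N = N₁ ∪_{b,s} N₂`, its bilinear law, `AG_twoSum`, and the same-type cases
`Hb_twoSum_sparse` / `Ha_twoSum_dense`); same conventions, pure algebra, no definitions, no sorries.

THEOREM (this file).  Let piece 1 be SPARSE-type (`AG₁ ≥ 0`, `Hb₁ ≥ 0`) and piece 2 DENSE-type (`AG₂ ≥ 0`, `Ha₂ ≥ 0`) — or the other way
round.  Then the 2-sum law `N` satisfies `Hb(N) ≥ 0` if it is sparse (`q_N ≥ t_N`) and `Ha(N) ≥ 0` if it is dense (`t_N ≥ q_N`):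
four identities `Hb/Ha_twoSum_sparse_dense`, `Hb/Ha_twoSum_dense_sparse`, each an INTEGER combination of 86 products of cells, `AG₁`,
`AG₂`, the pieces' sheets `Hb₁`/`Ha₂` (resp. `Ha₁`/`Hb₂`) and — in five terms — the OUTPUT margin `q_N − t_N` (resp. `t_N − q_N`); found by
linear programming (kit j112796 / j113063: the input margins `Q_i − T_i` are NOT needed here, the output margin is), re-checked by `ring`.
With part I this gives `maxH_twoSum_nonneg`: **the invariant `I = {cells ≥ 0, AG ≥ 0, max(Ha,Hb) ≥ 0}` is closed under the 2-sum**
(law level), the first closure operation for the sharp row that glues along a Steiner vertex.  Consequences (KCLUSTER-gen28 §6–§7):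
with the pendant move (`…TerminalClosure`) and the graph-level gluing theorems (`…CubicThreePointSharpRowGluing`), SF3-Hmax holds on every
bridged series composition `N₁(a,b) ∪_b N₂(b,c) + y·vw`, on {blob network + one cross edge} and {hub network + one chord}, whenever the
pieces' three-point laws lie in `I`; and a minimal counterexample to SF3-Hmax has no 2-separator `{terminal, Steiner vertex}` splitting the
other two terminals (terminal–terminal separators were excluded by the K3-semigroup theorem; Steiner–Steiner separators remain open).
[cite: Gladkov2024StrongFKG, Cor. 4.2 (the quadratic form AG)]; [cite: GladkovZimin2024HK, §4 (block decomposition along a separator)]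
-/

namespace Summit.CriticalPhenomena.PercolationContinuityZ3.Theorems

namespace CubicThreePointTwoSum

open CubicThreePointTerminal

variable {R : Type*} [CommRing R]

/-- **Mixed 2-sum, piece 1 sparse-type, piece 2 dense-type, output sparse (`q_N ≥ t_N`)**: `Hb(N)` = 86 products of cells,
`AG₁`, `AG₂`, `Hb₁`, `Ha₂` and the OUTPUT margin (5 of the 86 terms), integer coefficients (LP, kit j112796/j113063; identity in any commutative ring). [this work] -/
theorem Hb_twoSum_sparse_dense (T₁ A₁ B₁ V₁ Q₁ T₂ B₂ C₂ W₂ Q₂ : R) :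
    Hb (A₁ * C₂ + A₁ * Q₂ + B₁ * Q₂ + Q₁ * (B₂ + C₂ + Q₂))
      (T₁ * C₂ + T₁ * Q₂ + V₁ * (B₂ + C₂ + Q₂) + B₁ * C₂) (B₁ * B₂)
      (A₁ * (T₂ + W₂ + B₂) + B₁ * W₂ + Q₁ * (T₂ + W₂)) ((T₁ + V₁) * (T₂ + W₂) + T₁ * B₂ + B₁ * T₂)
    = T₁ * A₁ * B₁ * B₂ * C₂ * W₂ + T₁ * A₁ * B₁ * B₂ * W₂ * Q₂ + T₁ * A₁ * B₁ * (AG Q₂ B₂ C₂ W₂ T₂) * C₂ + T₁ * A₁ * B₁ * (AG Q₂ B₂ C₂ W₂ T₂) * Q₂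
     + T₁ * B₁ * B₁ * (AG Q₂ B₂ C₂ W₂ T₂) * B₂ + T₁ * B₁ * B₁ * (AG Q₂ B₂ C₂ W₂ T₂) * W₂ + T₁ * B₁ * B₁ * (AG Q₂ B₂ C₂ W₂ T₂) * Q₂
     + T₁ * B₁ * B₁ * (Ha Q₂ B₂ C₂ W₂ T₂) + T₁ * B₁ * Q₁ * (AG Q₂ B₂ C₂ W₂ T₂) * T₂ + T₁ * B₁ * Q₁ * (AG Q₂ B₂ C₂ W₂ T₂) * B₂
     + T₁ * B₁ * Q₁ * (AG Q₂ B₂ C₂ W₂ T₂) * C₂ + T₁ * B₁ * Q₁ * (AG Q₂ B₂ C₂ W₂ T₂) * W₂ + T₁ * B₁ * Q₁ * (AG Q₂ B₂ C₂ W₂ T₂) * Q₂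
     + A₁ * A₁ * B₁ * B₂ * C₂ * W₂ + A₁ * A₁ * B₁ * B₂ * W₂ * Q₂ + A₁ * A₁ * B₁ * (AG Q₂ B₂ C₂ W₂ T₂) * C₂ + A₁ * A₁ * B₁ * (AG Q₂ B₂ C₂ W₂ T₂) * Q₂
     + A₁ * B₁ * B₁ * B₂ * B₂ * W₂ + A₁ * B₁ * B₁ * B₂ * W₂ * Q₂ + A₁ * B₁ * B₁ * (AG Q₂ B₂ C₂ W₂ T₂) * B₂ + A₁ * B₁ * B₁ * (AG Q₂ B₂ C₂ W₂ T₂) * Q₂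
     + A₁ * B₁ * V₁ * T₂ * B₂ * C₂ + A₁ * B₁ * V₁ * T₂ * B₂ * Q₂ + A₁ * B₁ * V₁ * B₂ * C₂ * C₂ + A₁ * B₁ * V₁ * B₂ * C₂ * W₂
     + A₁ * B₁ * V₁ * B₂ * C₂ * Q₂ + A₁ * B₁ * V₁ * B₂ * W₂ * Q₂ + A₁ * B₁ * V₁ * (AG Q₂ B₂ C₂ W₂ T₂) * C₂ + A₁ * B₁ * V₁ * (AG Q₂ B₂ C₂ W₂ T₂) * Q₂
     + A₁ * B₁ * Q₁ * B₂ * B₂ * W₂ + A₁ * B₁ * Q₁ * B₂ * C₂ * W₂ + A₁ * B₁ * Q₁ * B₂ * W₂ * Q₂ + A₁ * B₁ * Q₁ * (AG Q₂ B₂ C₂ W₂ T₂) * B₂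
     + A₁ * B₁ * Q₁ * (AG Q₂ B₂ C₂ W₂ T₂) * C₂ + A₁ * B₁ * Q₁ * (AG Q₂ B₂ C₂ W₂ T₂) * Q₂ + B₁ * B₁ * B₁ * (Ha Q₂ B₂ C₂ W₂ T₂)
     + B₁ * B₁ * V₁ * B₂ * B₂ * C₂ + B₁ * B₁ * V₁ * B₂ * C₂ * Q₂ + B₁ * B₁ * V₁ * (AG Q₂ B₂ C₂ W₂ T₂) * T₂ + B₁ * B₁ * V₁ * (AG Q₂ B₂ C₂ W₂ T₂) * B₂
     + B₁ * B₁ * V₁ * (AG Q₂ B₂ C₂ W₂ T₂) * W₂ + B₁ * B₁ * V₁ * (AG Q₂ B₂ C₂ W₂ T₂) * Q₂ + B₁ * B₁ * Q₁ * (Ha Q₂ B₂ C₂ W₂ T₂)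
     + B₁ * V₁ * Q₁ * T₂ * B₂ * C₂ + B₁ * V₁ * Q₁ * B₂ * B₂ * C₂ + B₁ * V₁ * Q₁ * B₂ * C₂ * C₂ + B₁ * V₁ * Q₁ * B₂ * C₂ * W₂
     + B₁ * V₁ * Q₁ * B₂ * C₂ * Q₂ + B₁ * V₁ * Q₁ * (AG Q₂ B₂ C₂ W₂ T₂) * T₂ + B₁ * V₁ * Q₁ * (AG Q₂ B₂ C₂ W₂ T₂) * B₂
     + B₁ * V₁ * Q₁ * (AG Q₂ B₂ C₂ W₂ T₂) * C₂ + B₁ * V₁ * Q₁ * (AG Q₂ B₂ C₂ W₂ T₂) * W₂ + B₁ * V₁ * Q₁ * (AG Q₂ B₂ C₂ W₂ T₂) * Q₂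
     + (AG Q₁ A₁ B₁ V₁ T₁) * A₁ * T₂ * B₂ * C₂ + (AG Q₁ A₁ B₁ V₁ T₁) * A₁ * T₂ * B₂ * Q₂ + (AG Q₁ A₁ B₁ V₁ T₁) * A₁ * B₂ * B₂ * C₂
     + (AG Q₁ A₁ B₁ V₁ T₁) * A₁ * B₂ * B₂ * Q₂ + (AG Q₁ A₁ B₁ V₁ T₁) * A₁ * B₂ * C₂ * C₂ + (AG Q₁ A₁ B₁ V₁ T₁) * A₁ * B₂ * C₂ * W₂
     + 2 * (AG Q₁ A₁ B₁ V₁ T₁) * A₁ * B₂ * C₂ * Q₂ + (AG Q₁ A₁ B₁ V₁ T₁) * A₁ * B₂ * W₂ * Q₂ + (AG Q₁ A₁ B₁ V₁ T₁) * A₁ * B₂ * Q₂ * Q₂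
     + (AG Q₁ A₁ B₁ V₁ T₁) * B₁ * T₂ * B₂ * Q₂ + (AG Q₁ A₁ B₁ V₁ T₁) * B₁ * B₂ * B₂ * Q₂ + (AG Q₁ A₁ B₁ V₁ T₁) * B₁ * B₂ * C₂ * Q₂
     + (AG Q₁ A₁ B₁ V₁ T₁) * B₁ * B₂ * W₂ * Q₂ + (AG Q₁ A₁ B₁ V₁ T₁) * B₁ * B₂ * Q₂ * Q₂ + (AG Q₁ A₁ B₁ V₁ T₁) * Q₁ * T₂ * B₂ * C₂
     + (AG Q₁ A₁ B₁ V₁ T₁) * Q₁ * T₂ * B₂ * Q₂ + (AG Q₁ A₁ B₁ V₁ T₁) * Q₁ * B₂ * B₂ * C₂ + (AG Q₁ A₁ B₁ V₁ T₁) * Q₁ * B₂ * B₂ * Q₂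
     + (AG Q₁ A₁ B₁ V₁ T₁) * Q₁ * B₂ * C₂ * C₂ + (AG Q₁ A₁ B₁ V₁ T₁) * Q₁ * B₂ * C₂ * W₂ + 2 * (AG Q₁ A₁ B₁ V₁ T₁) * Q₁ * B₂ * C₂ * Q₂
     + (AG Q₁ A₁ B₁ V₁ T₁) * Q₁ * B₂ * W₂ * Q₂ + (AG Q₁ A₁ B₁ V₁ T₁) * Q₁ * B₂ * Q₂ * Q₂ + (Hb Q₁ A₁ B₁ V₁ T₁) * T₂ * B₂ * B₂
     + (Hb Q₁ A₁ B₁ V₁ T₁) * B₂ * B₂ * B₂ + (Hb Q₁ A₁ B₁ V₁ T₁) * B₂ * B₂ * C₂ + (Hb Q₁ A₁ B₁ V₁ T₁) * B₂ * B₂ * W₂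
     + (Hb Q₁ A₁ B₁ V₁ T₁) * B₂ * B₂ * Q₂
     + ((A₁ * C₂ + A₁ * Q₂ + B₁ * Q₂ + Q₁ * (B₂ + C₂ + Q₂)) - ((T₁ + V₁) * (T₂ + W₂) + T₁ * B₂ + B₁ * T₂)) * A₁ * B₁ * B₂ * C₂
     + ((A₁ * C₂ + A₁ * Q₂ + B₁ * Q₂ + Q₁ * (B₂ + C₂ + Q₂)) - ((T₁ + V₁) * (T₂ + W₂) + T₁ * B₂ + B₁ * T₂)) * A₁ * B₁ * B₂ * Q₂
     + ((A₁ * C₂ + A₁ * Q₂ + B₁ * Q₂ + Q₁ * (B₂ + C₂ + Q₂)) - ((T₁ + V₁) * (T₂ + W₂) + T₁ * B₂ + B₁ * T₂)) * B₁ * B₁ * (AG Q₂ B₂ C₂ W₂ T₂)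
     + ((A₁ * C₂ + A₁ * Q₂ + B₁ * Q₂ + Q₁ * (B₂ + C₂ + Q₂)) - ((T₁ + V₁) * (T₂ + W₂) + T₁ * B₂ + B₁ * T₂)) * B₁ * Q₁ * B₂ * C₂
     + ((A₁ * C₂ + A₁ * Q₂ + B₁ * Q₂ + Q₁ * (B₂ + C₂ + Q₂)) - ((T₁ + V₁) * (T₂ + W₂) + T₁ * B₂ + B₁ * T₂)) * B₁ * Q₁ * (AG Q₂ B₂ C₂ W₂ T₂) := by
  simp only [Hb, Ha, AG]; ring

/-- Sign form of `Hb_twoSum_sparse_dense`: for nonnegative cells, `AG₁, AG₂ ≥ 0`, `Hb₁ ≥ 0`, `Ha₂ ≥ 0` and the output regime sparse (`q_N ≥ t_N`), `0 ≤ Hb(N)`. [this work] -/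
theorem Hb_twoSum_sparse_dense_nonneg {T₁ A₁ B₁ V₁ Q₁ T₂ B₂ C₂ W₂ Q₂ : ℝ}
    (hT₁ : 0 ≤ T₁) (hA₁ : 0 ≤ A₁) (hB₁ : 0 ≤ B₁) (hV₁ : 0 ≤ V₁) (hQ₁ : 0 ≤ Q₁)
    (hT₂ : 0 ≤ T₂) (hB₂ : 0 ≤ B₂) (hC₂ : 0 ≤ C₂) (hW₂ : 0 ≤ W₂) (hQ₂ : 0 ≤ Q₂)
    (hAG₁ : 0 ≤ AG Q₁ A₁ B₁ V₁ T₁) (hAG₂ : 0 ≤ AG Q₂ B₂ C₂ W₂ T₂)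
    (hH₁ : 0 ≤ Hb Q₁ A₁ B₁ V₁ T₁) (hH₂ : 0 ≤ Ha Q₂ B₂ C₂ W₂ T₂)
    (hN : ((T₁ + V₁) * (T₂ + W₂) + T₁ * B₂ + B₁ * T₂) ≤ (A₁ * C₂ + A₁ * Q₂ + B₁ * Q₂ + Q₁ * (B₂ + C₂ + Q₂))) :
    0 ≤ Hb (A₁ * C₂ + A₁ * Q₂ + B₁ * Q₂ + Q₁ * (B₂ + C₂ + Q₂))
      (T₁ * C₂ + T₁ * Q₂ + V₁ * (B₂ + C₂ + Q₂) + B₁ * C₂) (B₁ * B₂)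
      (A₁ * (T₂ + W₂ + B₂) + B₁ * W₂ + Q₁ * (T₂ + W₂)) ((T₁ + V₁) * (T₂ + W₂) + T₁ * B₂ + B₁ * T₂) := by
  rw [Hb_twoSum_sparse_dense]
  have hr : 0 ≤ (A₁ * C₂ + A₁ * Q₂ + B₁ * Q₂ + Q₁ * (B₂ + C₂ + Q₂)) - ((T₁ + V₁) * (T₂ + W₂) + T₁ * B₂ + B₁ * T₂) := sub_nonneg.2 hN
  generalize (A₁ * C₂ + A₁ * Q₂ + B₁ * Q₂ + Q₁ * (B₂ + C₂ + Q₂)) - ((T₁ + V₁) * (T₂ + W₂) + T₁ * B₂ + B₁ * T₂) = r at hr ⊢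
  generalize AG Q₁ A₁ B₁ V₁ T₁ = G₁ at hAG₁ ⊢
  generalize AG Q₂ B₂ C₂ W₂ T₂ = G₂ at hAG₂ ⊢
  generalize Hb Q₁ A₁ B₁ V₁ T₁ = K₁ at hH₁ ⊢
  generalize Ha Q₂ B₂ C₂ W₂ T₂ = K₂ at hH₂ ⊢
  positivity

/-- **Mixed 2-sum, piece 1 sparse-type, piece 2 dense-type, output dense (`t_N ≥ q_N`)**: `Ha(N)` = 86 products of cells,
`AG₁`, `AG₂`, `Hb₁`, `Ha₂` and the OUTPUT margin (5 of the 86 terms), integer coefficients (LP, kit j112796/j113063; identity in any commutative ring). [this work] -/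
theorem Ha_twoSum_sparse_dense (T₁ A₁ B₁ V₁ Q₁ T₂ B₂ C₂ W₂ Q₂ : R) :
    Ha (A₁ * C₂ + A₁ * Q₂ + B₁ * Q₂ + Q₁ * (B₂ + C₂ + Q₂))
      (T₁ * C₂ + T₁ * Q₂ + V₁ * (B₂ + C₂ + Q₂) + B₁ * C₂) (B₁ * B₂)
      (A₁ * (T₂ + W₂ + B₂) + B₁ * W₂ + Q₁ * (T₂ + W₂)) ((T₁ + V₁) * (T₂ + W₂) + T₁ * B₂ + B₁ * T₂)
    = T₁ * T₁ * B₁ * (AG Q₂ B₂ C₂ W₂ T₂) * T₂ + T₁ * T₁ * B₁ * (AG Q₂ B₂ C₂ W₂ T₂) * B₂ + T₁ * T₁ * B₁ * (AG Q₂ B₂ C₂ W₂ T₂) * W₂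
     + T₁ * A₁ * B₁ * T₂ * B₂ * W₂ + T₁ * A₁ * B₁ * B₂ * B₂ * W₂ + T₁ * A₁ * B₁ * B₂ * C₂ * W₂ + T₁ * A₁ * B₁ * B₂ * W₂ * W₂
     + T₁ * A₁ * B₁ * B₂ * W₂ * Q₂ + T₁ * A₁ * B₁ * (AG Q₂ B₂ C₂ W₂ T₂) * T₂ + T₁ * A₁ * B₁ * (AG Q₂ B₂ C₂ W₂ T₂) * B₂
     + T₁ * A₁ * B₁ * (AG Q₂ B₂ C₂ W₂ T₂) * W₂ + T₁ * B₁ * B₁ * (AG Q₂ B₂ C₂ W₂ T₂) * T₂ + T₁ * B₁ * B₁ * (AG Q₂ B₂ C₂ W₂ T₂) * B₂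
     + T₁ * B₁ * B₁ * (AG Q₂ B₂ C₂ W₂ T₂) * W₂ + T₁ * B₁ * B₁ * (Ha Q₂ B₂ C₂ W₂ T₂) + T₁ * B₁ * V₁ * T₂ * B₂ * C₂ + T₁ * B₁ * V₁ * B₂ * B₂ * C₂
     + T₁ * B₁ * V₁ * B₂ * C₂ * W₂ + 2 * T₁ * B₁ * V₁ * (AG Q₂ B₂ C₂ W₂ T₂) * T₂ + T₁ * B₁ * V₁ * (AG Q₂ B₂ C₂ W₂ T₂) * B₂
     + 2 * T₁ * B₁ * V₁ * (AG Q₂ B₂ C₂ W₂ T₂) * W₂ + T₁ * B₁ * Q₁ * B₂ * C₂ * W₂ + T₁ * B₁ * Q₁ * (AG Q₂ B₂ C₂ W₂ T₂) * T₂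
     + T₁ * B₁ * Q₁ * (AG Q₂ B₂ C₂ W₂ T₂) * B₂ + T₁ * B₁ * Q₁ * (AG Q₂ B₂ C₂ W₂ T₂) * W₂ + A₁ * B₁ * B₁ * T₂ * B₂ * W₂ + A₁ * B₁ * B₁ * B₂ * B₂ * W₂
     + A₁ * B₁ * B₁ * (Ha Q₂ B₂ C₂ W₂ T₂) + A₁ * B₁ * V₁ * T₂ * B₂ * C₂ + A₁ * B₁ * V₁ * T₂ * B₂ * W₂ + A₁ * B₁ * V₁ * B₂ * C₂ * W₂
     + A₁ * B₁ * V₁ * B₂ * W₂ * W₂ + A₁ * B₁ * V₁ * B₂ * W₂ * Q₂ + A₁ * B₁ * V₁ * (AG Q₂ B₂ C₂ W₂ T₂) * T₂ + A₁ * B₁ * V₁ * (AG Q₂ B₂ C₂ W₂ T₂) * W₂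
     + B₁ * B₁ * B₁ * (Ha Q₂ B₂ C₂ W₂ T₂) + B₁ * B₁ * V₁ * T₂ * B₂ * C₂ + B₁ * B₁ * V₁ * B₂ * B₂ * C₂ + B₁ * B₁ * V₁ * (AG Q₂ B₂ C₂ W₂ T₂) * T₂
     + B₁ * B₁ * V₁ * (AG Q₂ B₂ C₂ W₂ T₂) * W₂ + B₁ * B₁ * V₁ * (Ha Q₂ B₂ C₂ W₂ T₂) + B₁ * B₁ * Q₁ * (Ha Q₂ B₂ C₂ W₂ T₂) + B₁ * V₁ * V₁ * T₂ * B₂ * C₂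
     + B₁ * V₁ * V₁ * B₂ * C₂ * W₂ + B₁ * V₁ * V₁ * (AG Q₂ B₂ C₂ W₂ T₂) * T₂ + B₁ * V₁ * V₁ * (AG Q₂ B₂ C₂ W₂ T₂) * W₂ + B₁ * V₁ * Q₁ * T₂ * B₂ * C₂
     + B₁ * V₁ * Q₁ * B₂ * C₂ * W₂ + B₁ * V₁ * Q₁ * (AG Q₂ B₂ C₂ W₂ T₂) * T₂ + B₁ * V₁ * Q₁ * (AG Q₂ B₂ C₂ W₂ T₂) * W₂
     + (AG Q₁ A₁ B₁ V₁ T₁) * T₁ * T₂ * B₂ * C₂ + (AG Q₁ A₁ B₁ V₁ T₁) * T₁ * T₂ * B₂ * W₂ + (AG Q₁ A₁ B₁ V₁ T₁) * T₁ * T₂ * B₂ * Q₂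
     + (AG Q₁ A₁ B₁ V₁ T₁) * T₁ * B₂ * B₂ * C₂ + (AG Q₁ A₁ B₁ V₁ T₁) * T₁ * B₂ * B₂ * W₂ + (AG Q₁ A₁ B₁ V₁ T₁) * T₁ * B₂ * B₂ * Q₂
     + (AG Q₁ A₁ B₁ V₁ T₁) * T₁ * B₂ * C₂ * W₂ + (AG Q₁ A₁ B₁ V₁ T₁) * T₁ * B₂ * W₂ * W₂ + (AG Q₁ A₁ B₁ V₁ T₁) * T₁ * B₂ * W₂ * Q₂
     + (AG Q₁ A₁ B₁ V₁ T₁) * A₁ * T₂ * B₂ * C₂ + (AG Q₁ A₁ B₁ V₁ T₁) * A₁ * T₂ * B₂ * Q₂ + (AG Q₁ A₁ B₁ V₁ T₁) * A₁ * B₂ * B₂ * C₂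
     + (AG Q₁ A₁ B₁ V₁ T₁) * A₁ * B₂ * B₂ * Q₂ + (AG Q₁ A₁ B₁ V₁ T₁) * B₁ * T₂ * B₂ * C₂ + (AG Q₁ A₁ B₁ V₁ T₁) * B₁ * T₂ * B₂ * W₂
     + (AG Q₁ A₁ B₁ V₁ T₁) * B₁ * T₂ * B₂ * Q₂ + (AG Q₁ A₁ B₁ V₁ T₁) * B₁ * B₂ * B₂ * C₂ + (AG Q₁ A₁ B₁ V₁ T₁) * B₁ * B₂ * B₂ * W₂
     + (AG Q₁ A₁ B₁ V₁ T₁) * B₁ * B₂ * B₂ * Q₂ + (AG Q₁ A₁ B₁ V₁ T₁) * V₁ * T₂ * B₂ * C₂ + (AG Q₁ A₁ B₁ V₁ T₁) * V₁ * T₂ * B₂ * W₂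
     + (AG Q₁ A₁ B₁ V₁ T₁) * V₁ * T₂ * B₂ * Q₂ + (AG Q₁ A₁ B₁ V₁ T₁) * V₁ * B₂ * C₂ * W₂ + (AG Q₁ A₁ B₁ V₁ T₁) * V₁ * B₂ * W₂ * W₂
     + (AG Q₁ A₁ B₁ V₁ T₁) * V₁ * B₂ * W₂ * Q₂ + (AG Q₁ A₁ B₁ V₁ T₁) * Q₁ * T₂ * B₂ * C₂ + (AG Q₁ A₁ B₁ V₁ T₁) * Q₁ * T₂ * B₂ * Q₂
     + (AG Q₁ A₁ B₁ V₁ T₁) * Q₁ * B₂ * B₂ * C₂ + (Hb Q₁ A₁ B₁ V₁ T₁) * T₂ * B₂ * B₂ + (Hb Q₁ A₁ B₁ V₁ T₁) * B₂ * B₂ * B₂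
     + (Hb Q₁ A₁ B₁ V₁ T₁) * B₂ * B₂ * Q₂
     + (((T₁ + V₁) * (T₂ + W₂) + T₁ * B₂ + B₁ * T₂) - (A₁ * C₂ + A₁ * Q₂ + B₁ * Q₂ + Q₁ * (B₂ + C₂ + Q₂))) * T₁ * B₁ * B₂ * W₂
     + (((T₁ + V₁) * (T₂ + W₂) + T₁ * B₂ + B₁ * T₂) - (A₁ * C₂ + A₁ * Q₂ + B₁ * Q₂ + Q₁ * (B₂ + C₂ + Q₂))) * B₁ * V₁ * T₂ * B₂
     + (((T₁ + V₁) * (T₂ + W₂) + T₁ * B₂ + B₁ * T₂) - (A₁ * C₂ + A₁ * Q₂ + B₁ * Q₂ + Q₁ * (B₂ + C₂ + Q₂))) * B₁ * V₁ * B₂ * W₂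
     + (((T₁ + V₁) * (T₂ + W₂) + T₁ * B₂ + B₁ * T₂) - (A₁ * C₂ + A₁ * Q₂ + B₁ * Q₂ + Q₁ * (B₂ + C₂ + Q₂))) * (AG Q₁ A₁ B₁ V₁ T₁) * T₂ * B₂
     + (((T₁ + V₁) * (T₂ + W₂) + T₁ * B₂ + B₁ * T₂) - (A₁ * C₂ + A₁ * Q₂ + B₁ * Q₂ + Q₁ * (B₂ + C₂ + Q₂))) * (AG Q₁ A₁ B₁ V₁ T₁) * B₂ * B₂ := by
  simp only [Ha, Hb, AG]; ring

/-- Sign form of `Ha_twoSum_sparse_dense`: for nonnegative cells, `AG₁, AG₂ ≥ 0`, `Hb₁ ≥ 0`, `Ha₂ ≥ 0` and the output regime dense (`t_N ≥ q_N`), `0 ≤ Ha(N)`. [this work] -/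
theorem Ha_twoSum_sparse_dense_nonneg {T₁ A₁ B₁ V₁ Q₁ T₂ B₂ C₂ W₂ Q₂ : ℝ}
    (hT₁ : 0 ≤ T₁) (hA₁ : 0 ≤ A₁) (hB₁ : 0 ≤ B₁) (hV₁ : 0 ≤ V₁) (hQ₁ : 0 ≤ Q₁)
    (hT₂ : 0 ≤ T₂) (hB₂ : 0 ≤ B₂) (hC₂ : 0 ≤ C₂) (hW₂ : 0 ≤ W₂) (hQ₂ : 0 ≤ Q₂)
    (hAG₁ : 0 ≤ AG Q₁ A₁ B₁ V₁ T₁) (hAG₂ : 0 ≤ AG Q₂ B₂ C₂ W₂ T₂)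
    (hH₁ : 0 ≤ Hb Q₁ A₁ B₁ V₁ T₁) (hH₂ : 0 ≤ Ha Q₂ B₂ C₂ W₂ T₂)
    (hN : (A₁ * C₂ + A₁ * Q₂ + B₁ * Q₂ + Q₁ * (B₂ + C₂ + Q₂)) ≤ ((T₁ + V₁) * (T₂ + W₂) + T₁ * B₂ + B₁ * T₂)) :
    0 ≤ Ha (A₁ * C₂ + A₁ * Q₂ + B₁ * Q₂ + Q₁ * (B₂ + C₂ + Q₂))
      (T₁ * C₂ + T₁ * Q₂ + V₁ * (B₂ + C₂ + Q₂) + B₁ * C₂) (B₁ * B₂)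
      (A₁ * (T₂ + W₂ + B₂) + B₁ * W₂ + Q₁ * (T₂ + W₂)) ((T₁ + V₁) * (T₂ + W₂) + T₁ * B₂ + B₁ * T₂) := by
  rw [Ha_twoSum_sparse_dense]
  have hr : 0 ≤ ((T₁ + V₁) * (T₂ + W₂) + T₁ * B₂ + B₁ * T₂) - (A₁ * C₂ + A₁ * Q₂ + B₁ * Q₂ + Q₁ * (B₂ + C₂ + Q₂)) := sub_nonneg.2 hN
  generalize ((T₁ + V₁) * (T₂ + W₂) + T₁ * B₂ + B₁ * T₂) - (A₁ * C₂ + A₁ * Q₂ + B₁ * Q₂ + Q₁ * (B₂ + C₂ + Q₂)) = r at hr ⊢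
  generalize AG Q₁ A₁ B₁ V₁ T₁ = G₁ at hAG₁ ⊢
  generalize AG Q₂ B₂ C₂ W₂ T₂ = G₂ at hAG₂ ⊢
  generalize Hb Q₁ A₁ B₁ V₁ T₁ = K₁ at hH₁ ⊢
  generalize Ha Q₂ B₂ C₂ W₂ T₂ = K₂ at hH₂ ⊢
  positivity

/-- **Mixed 2-sum, piece 1 dense-type, piece 2 sparse-type, output sparse (`q_N ≥ t_N`)**: `Hb(N)` = 86 products of cells,
`AG₁`, `AG₂`, `Ha₁`, `Hb₂` and the OUTPUT margin (5 of the 86 terms), integer coefficients (LP, kit j112796/j113063; identity in any commutative ring). [this work] -/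
theorem Hb_twoSum_dense_sparse (T₁ A₁ B₁ V₁ Q₁ T₂ B₂ C₂ W₂ Q₂ : R) :
    Hb (A₁ * C₂ + A₁ * Q₂ + B₁ * Q₂ + Q₁ * (B₂ + C₂ + Q₂))
      (T₁ * C₂ + T₁ * Q₂ + V₁ * (B₂ + C₂ + Q₂) + B₁ * C₂) (B₁ * B₂)
      (A₁ * (T₂ + W₂ + B₂) + B₁ * W₂ + Q₁ * (T₂ + W₂)) ((T₁ + V₁) * (T₂ + W₂) + T₁ * B₂ + B₁ * T₂)
    = T₁ * A₁ * B₁ * B₂ * C₂ * W₂ + T₁ * A₁ * B₁ * B₂ * W₂ * Q₂ + T₁ * A₁ * B₁ * (AG Q₂ B₂ C₂ W₂ T₂) * C₂ + T₁ * A₁ * B₁ * (AG Q₂ B₂ C₂ W₂ T₂) * Q₂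
     + T₁ * B₁ * B₁ * (Hb Q₂ B₂ C₂ W₂ T₂) + T₁ * B₁ * Q₁ * B₂ * C₂ * W₂ + T₁ * B₁ * Q₁ * (AG Q₂ B₂ C₂ W₂ T₂) * B₂
     + T₁ * B₁ * Q₁ * (AG Q₂ B₂ C₂ W₂ T₂) * C₂ + T₁ * B₁ * Q₁ * (AG Q₂ B₂ C₂ W₂ T₂) * Q₂ + A₁ * A₁ * B₁ * B₂ * C₂ * W₂ + A₁ * A₁ * B₁ * B₂ * W₂ * Q₂
     + A₁ * A₁ * B₁ * (AG Q₂ B₂ C₂ W₂ T₂) * C₂ + A₁ * A₁ * B₁ * (AG Q₂ B₂ C₂ W₂ T₂) * Q₂ + A₁ * B₁ * B₁ * B₂ * B₂ * W₂ + A₁ * B₁ * B₁ * B₂ * W₂ * Q₂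
     + A₁ * B₁ * B₁ * (AG Q₂ B₂ C₂ W₂ T₂) * C₂ + A₁ * B₁ * B₁ * (AG Q₂ B₂ C₂ W₂ T₂) * Q₂ + A₁ * B₁ * B₁ * (Hb Q₂ B₂ C₂ W₂ T₂)
     + A₁ * B₁ * V₁ * T₂ * B₂ * C₂ + A₁ * B₁ * V₁ * B₂ * C₂ * C₂ + A₁ * B₁ * V₁ * B₂ * C₂ * W₂ + A₁ * B₁ * V₁ * B₂ * C₂ * Q₂
     + A₁ * B₁ * V₁ * B₂ * W₂ * Q₂ + A₁ * B₁ * V₁ * (AG Q₂ B₂ C₂ W₂ T₂) * C₂ + A₁ * B₁ * V₁ * (AG Q₂ B₂ C₂ W₂ T₂) * Q₂ + A₁ * B₁ * Q₁ * B₂ * B₂ * W₂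
     + A₁ * B₁ * Q₁ * B₂ * C₂ * W₂ + A₁ * B₁ * Q₁ * B₂ * W₂ * Q₂ + A₁ * B₁ * Q₁ * (AG Q₂ B₂ C₂ W₂ T₂) * B₂
     + 2 * A₁ * B₁ * Q₁ * (AG Q₂ B₂ C₂ W₂ T₂) * C₂ + 2 * A₁ * B₁ * Q₁ * (AG Q₂ B₂ C₂ W₂ T₂) * Q₂ + B₁ * B₁ * B₁ * (Hb Q₂ B₂ C₂ W₂ T₂)
     + B₁ * B₁ * V₁ * B₂ * B₂ * C₂ + B₁ * B₁ * V₁ * B₂ * C₂ * Q₂ + B₁ * B₁ * V₁ * (Hb Q₂ B₂ C₂ W₂ T₂) + B₁ * B₁ * Q₁ * (AG Q₂ B₂ C₂ W₂ T₂) * B₂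
     + B₁ * B₁ * Q₁ * (AG Q₂ B₂ C₂ W₂ T₂) * C₂ + B₁ * B₁ * Q₁ * (AG Q₂ B₂ C₂ W₂ T₂) * Q₂ + B₁ * B₁ * Q₁ * (Hb Q₂ B₂ C₂ W₂ T₂)
     + B₁ * V₁ * Q₁ * T₂ * B₂ * C₂ + B₁ * V₁ * Q₁ * B₂ * B₂ * C₂ + B₁ * V₁ * Q₁ * B₂ * C₂ * C₂ + B₁ * V₁ * Q₁ * B₂ * C₂ * W₂
     + B₁ * V₁ * Q₁ * B₂ * C₂ * Q₂ + B₁ * V₁ * Q₁ * (AG Q₂ B₂ C₂ W₂ T₂) * B₂ + B₁ * V₁ * Q₁ * (AG Q₂ B₂ C₂ W₂ T₂) * C₂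
     + B₁ * V₁ * Q₁ * (AG Q₂ B₂ C₂ W₂ T₂) * Q₂ + B₁ * Q₁ * Q₁ * (AG Q₂ B₂ C₂ W₂ T₂) * B₂ + B₁ * Q₁ * Q₁ * (AG Q₂ B₂ C₂ W₂ T₂) * C₂
     + B₁ * Q₁ * Q₁ * (AG Q₂ B₂ C₂ W₂ T₂) * Q₂ + (AG Q₁ A₁ B₁ V₁ T₁) * T₁ * T₂ * B₂ * Q₂ + (AG Q₁ A₁ B₁ V₁ T₁) * T₁ * B₂ * B₂ * W₂
     + (AG Q₁ A₁ B₁ V₁ T₁) * T₁ * B₂ * W₂ * Q₂ + (AG Q₁ A₁ B₁ V₁ T₁) * A₁ * T₂ * B₂ * C₂ + (AG Q₁ A₁ B₁ V₁ T₁) * A₁ * T₂ * B₂ * Q₂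
     + (AG Q₁ A₁ B₁ V₁ T₁) * A₁ * B₂ * C₂ * C₂ + (AG Q₁ A₁ B₁ V₁ T₁) * A₁ * B₂ * C₂ * W₂ + (AG Q₁ A₁ B₁ V₁ T₁) * A₁ * B₂ * C₂ * Q₂
     + (AG Q₁ A₁ B₁ V₁ T₁) * A₁ * B₂ * W₂ * Q₂ + (AG Q₁ A₁ B₁ V₁ T₁) * B₁ * T₂ * B₂ * B₂ + (AG Q₁ A₁ B₁ V₁ T₁) * B₁ * T₂ * B₂ * Q₂
     + (AG Q₁ A₁ B₁ V₁ T₁) * B₁ * B₂ * B₂ * C₂ + (AG Q₁ A₁ B₁ V₁ T₁) * B₁ * B₂ * B₂ * W₂ + (AG Q₁ A₁ B₁ V₁ T₁) * B₁ * B₂ * C₂ * Q₂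
     + (AG Q₁ A₁ B₁ V₁ T₁) * B₁ * B₂ * W₂ * Q₂ + (AG Q₁ A₁ B₁ V₁ T₁) * V₁ * T₂ * B₂ * B₂ + (AG Q₁ A₁ B₁ V₁ T₁) * V₁ * T₂ * B₂ * Q₂
     + (AG Q₁ A₁ B₁ V₁ T₁) * V₁ * B₂ * B₂ * W₂ + (AG Q₁ A₁ B₁ V₁ T₁) * V₁ * B₂ * W₂ * Q₂ + (AG Q₁ A₁ B₁ V₁ T₁) * Q₁ * T₂ * B₂ * B₂
     + (AG Q₁ A₁ B₁ V₁ T₁) * Q₁ * T₂ * B₂ * C₂ + (AG Q₁ A₁ B₁ V₁ T₁) * Q₁ * T₂ * B₂ * Q₂ + (AG Q₁ A₁ B₁ V₁ T₁) * Q₁ * B₂ * B₂ * C₂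
     + (AG Q₁ A₁ B₁ V₁ T₁) * Q₁ * B₂ * B₂ * W₂ + (AG Q₁ A₁ B₁ V₁ T₁) * Q₁ * B₂ * C₂ * C₂ + (AG Q₁ A₁ B₁ V₁ T₁) * Q₁ * B₂ * C₂ * W₂
     + (AG Q₁ A₁ B₁ V₁ T₁) * Q₁ * B₂ * C₂ * Q₂ + (AG Q₁ A₁ B₁ V₁ T₁) * Q₁ * B₂ * W₂ * Q₂ + (Ha Q₁ A₁ B₁ V₁ T₁) * T₂ * B₂ * B₂
     + (Ha Q₁ A₁ B₁ V₁ T₁) * B₂ * B₂ * B₂ + (Ha Q₁ A₁ B₁ V₁ T₁) * B₂ * B₂ * Q₂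
     + ((A₁ * C₂ + A₁ * Q₂ + B₁ * Q₂ + Q₁ * (B₂ + C₂ + Q₂)) - ((T₁ + V₁) * (T₂ + W₂) + T₁ * B₂ + B₁ * T₂)) * A₁ * B₁ * B₂ * C₂
     + ((A₁ * C₂ + A₁ * Q₂ + B₁ * Q₂ + Q₁ * (B₂ + C₂ + Q₂)) - ((T₁ + V₁) * (T₂ + W₂) + T₁ * B₂ + B₁ * T₂)) * A₁ * B₁ * B₂ * Q₂
     + ((A₁ * C₂ + A₁ * Q₂ + B₁ * Q₂ + Q₁ * (B₂ + C₂ + Q₂)) - ((T₁ + V₁) * (T₂ + W₂) + T₁ * B₂ + B₁ * T₂)) * B₁ * Q₁ * B₂ * C₂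
     + ((A₁ * C₂ + A₁ * Q₂ + B₁ * Q₂ + Q₁ * (B₂ + C₂ + Q₂)) - ((T₁ + V₁) * (T₂ + W₂) + T₁ * B₂ + B₁ * T₂)) * (AG Q₁ A₁ B₁ V₁ T₁) * B₂ * B₂
     + ((A₁ * C₂ + A₁ * Q₂ + B₁ * Q₂ + Q₁ * (B₂ + C₂ + Q₂)) - ((T₁ + V₁) * (T₂ + W₂) + T₁ * B₂ + B₁ * T₂)) * (AG Q₁ A₁ B₁ V₁ T₁) * B₂ * Q₂ := by
  simp only [Hb, Ha, AG]; ring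

/-- Sign form of `Hb_twoSum_dense_sparse`: for nonnegative cells, `AG₁, AG₂ ≥ 0`, `Ha₁ ≥ 0`, `Hb₂ ≥ 0` and the output regime sparse (`q_N ≥ t_N`), `0 ≤ Hb(N)`. [this work] -/
theorem Hb_twoSum_dense_sparse_nonneg {T₁ A₁ B₁ V₁ Q₁ T₂ B₂ C₂ W₂ Q₂ : ℝ}
    (hT₁ : 0 ≤ T₁) (hA₁ : 0 ≤ A₁) (hB₁ : 0 ≤ B₁) (hV₁ : 0 ≤ V₁) (hQ₁ : 0 ≤ Q₁)
    (hT₂ : 0 ≤ T₂) (hB₂ : 0 ≤ B₂) (hC₂ : 0 ≤ C₂) (hW₂ : 0 ≤ W₂) (hQ₂ : 0 ≤ Q₂)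
    (hAG₁ : 0 ≤ AG Q₁ A₁ B₁ V₁ T₁) (hAG₂ : 0 ≤ AG Q₂ B₂ C₂ W₂ T₂)
    (hH₁ : 0 ≤ Ha Q₁ A₁ B₁ V₁ T₁) (hH₂ : 0 ≤ Hb Q₂ B₂ C₂ W₂ T₂)
    (hN : ((T₁ + V₁) * (T₂ + W₂) + T₁ * B₂ + B₁ * T₂) ≤ (A₁ * C₂ + A₁ * Q₂ + B₁ * Q₂ + Q₁ * (B₂ + C₂ + Q₂))) :
    0 ≤ Hb (A₁ * C₂ + A₁ * Q₂ + B₁ * Q₂ + Q₁ * (B₂ + C₂ + Q₂))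
      (T₁ * C₂ + T₁ * Q₂ + V₁ * (B₂ + C₂ + Q₂) + B₁ * C₂) (B₁ * B₂)
      (A₁ * (T₂ + W₂ + B₂) + B₁ * W₂ + Q₁ * (T₂ + W₂)) ((T₁ + V₁) * (T₂ + W₂) + T₁ * B₂ + B₁ * T₂) := by
  rw [Hb_twoSum_dense_sparse]
  have hr : 0 ≤ (A₁ * C₂ + A₁ * Q₂ + B₁ * Q₂ + Q₁ * (B₂ + C₂ + Q₂)) - ((T₁ + V₁) * (T₂ + W₂) + T₁ * B₂ + B₁ * T₂) := sub_nonneg.2 hN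
  generalize (A₁ * C₂ + A₁ * Q₂ + B₁ * Q₂ + Q₁ * (B₂ + C₂ + Q₂)) - ((T₁ + V₁) * (T₂ + W₂) + T₁ * B₂ + B₁ * T₂) = r at hr ⊢
  generalize AG Q₁ A₁ B₁ V₁ T₁ = G₁ at hAG₁ ⊢
  generalize AG Q₂ B₂ C₂ W₂ T₂ = G₂ at hAG₂ ⊢
  generalize Ha Q₁ A₁ B₁ V₁ T₁ = K₁ at hH₁ ⊢
  generalize Hb Q₂ B₂ C₂ W₂ T₂ = K₂ at hH₂ ⊢
  positivity

/-- **Mixed 2-sum, piece 1 dense-type, piece 2 sparse-type, output dense (`t_N ≥ q_N`)**: `Ha(N)` = 86 products of cells,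
`AG₁`, `AG₂`, `Ha₁`, `Hb₂` and the OUTPUT margin (5 of the 86 terms), integer coefficients (LP, kit j112796/j113063; identity in any commutative ring). [this work] -/
theorem Ha_twoSum_dense_sparse (T₁ A₁ B₁ V₁ Q₁ T₂ B₂ C₂ W₂ Q₂ : R) :
    Ha (A₁ * C₂ + A₁ * Q₂ + B₁ * Q₂ + Q₁ * (B₂ + C₂ + Q₂))
      (T₁ * C₂ + T₁ * Q₂ + V₁ * (B₂ + C₂ + Q₂) + B₁ * C₂) (B₁ * B₂)
      (A₁ * (T₂ + W₂ + B₂) + B₁ * W₂ + Q₁ * (T₂ + W₂)) ((T₁ + V₁) * (T₂ + W₂) + T₁ * B₂ + B₁ * T₂)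
    = T₁ * A₁ * B₁ * T₂ * B₂ * W₂ + T₁ * A₁ * B₁ * B₂ * B₂ * W₂ + T₁ * A₁ * B₁ * B₂ * C₂ * W₂ + T₁ * A₁ * B₁ * B₂ * W₂ * W₂ + T₁ * A₁ * B₁ * B₂ * W₂ * Q₂
     + T₁ * A₁ * B₁ * (AG Q₂ B₂ C₂ W₂ T₂) * T₂ + T₁ * A₁ * B₁ * (AG Q₂ B₂ C₂ W₂ T₂) * B₂ + T₁ * A₁ * B₁ * (AG Q₂ B₂ C₂ W₂ T₂) * C₂
     + T₁ * A₁ * B₁ * (AG Q₂ B₂ C₂ W₂ T₂) * W₂ + T₁ * A₁ * B₁ * (AG Q₂ B₂ C₂ W₂ T₂) * Q₂ + T₁ * B₁ * B₁ * (Hb Q₂ B₂ C₂ W₂ T₂)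
     + T₁ * B₁ * V₁ * T₂ * B₂ * C₂ + T₁ * B₁ * V₁ * B₂ * B₂ * C₂ + T₁ * B₁ * V₁ * B₂ * C₂ * W₂ + T₁ * B₁ * V₁ * (AG Q₂ B₂ C₂ W₂ T₂) * T₂
     + T₁ * B₁ * V₁ * (AG Q₂ B₂ C₂ W₂ T₂) * B₂ + T₁ * B₁ * V₁ * (AG Q₂ B₂ C₂ W₂ T₂) * W₂ + T₁ * B₁ * Q₁ * (AG Q₂ B₂ C₂ W₂ T₂) * T₂
     + T₁ * B₁ * Q₁ * (AG Q₂ B₂ C₂ W₂ T₂) * B₂ + T₁ * B₁ * Q₁ * (AG Q₂ B₂ C₂ W₂ T₂) * C₂ + T₁ * B₁ * Q₁ * (AG Q₂ B₂ C₂ W₂ T₂) * W₂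
     + T₁ * B₁ * Q₁ * (AG Q₂ B₂ C₂ W₂ T₂) * Q₂ + A₁ * B₁ * B₁ * T₂ * B₂ * W₂ + A₁ * B₁ * B₁ * B₂ * B₂ * W₂ + A₁ * B₁ * B₁ * (AG Q₂ B₂ C₂ W₂ T₂) * T₂
     + A₁ * B₁ * B₁ * (AG Q₂ B₂ C₂ W₂ T₂) * B₂ + A₁ * B₁ * B₁ * (AG Q₂ B₂ C₂ W₂ T₂) * C₂ + A₁ * B₁ * B₁ * (AG Q₂ B₂ C₂ W₂ T₂) * Q₂
     + A₁ * B₁ * V₁ * T₂ * B₂ * C₂ + A₁ * B₁ * V₁ * T₂ * B₂ * W₂ + A₁ * B₁ * V₁ * T₂ * B₂ * Q₂ + A₁ * B₁ * V₁ * B₂ * C₂ * W₂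
     + A₁ * B₁ * V₁ * B₂ * W₂ * W₂ + A₁ * B₁ * V₁ * B₂ * W₂ * Q₂ + A₁ * B₁ * V₁ * (AG Q₂ B₂ C₂ W₂ T₂) * T₂ + A₁ * B₁ * V₁ * (AG Q₂ B₂ C₂ W₂ T₂) * W₂
     + B₁ * B₁ * B₁ * (Hb Q₂ B₂ C₂ W₂ T₂) + B₁ * B₁ * V₁ * T₂ * B₂ * C₂ + B₁ * B₁ * V₁ * B₂ * B₂ * C₂ + B₁ * B₁ * V₁ * (AG Q₂ B₂ C₂ W₂ T₂) * T₂
     + B₁ * B₁ * V₁ * (AG Q₂ B₂ C₂ W₂ T₂) * B₂ + B₁ * B₁ * Q₁ * (AG Q₂ B₂ C₂ W₂ T₂) * T₂ + B₁ * B₁ * Q₁ * (AG Q₂ B₂ C₂ W₂ T₂) * B₂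
     + B₁ * B₁ * Q₁ * (AG Q₂ B₂ C₂ W₂ T₂) * C₂ + B₁ * B₁ * Q₁ * (Hb Q₂ B₂ C₂ W₂ T₂) + B₁ * V₁ * V₁ * T₂ * B₂ * C₂ + B₁ * V₁ * V₁ * B₂ * C₂ * W₂
     + B₁ * V₁ * V₁ * (AG Q₂ B₂ C₂ W₂ T₂) * T₂ + B₁ * V₁ * V₁ * (AG Q₂ B₂ C₂ W₂ T₂) * W₂ + B₁ * V₁ * Q₁ * T₂ * B₂ * C₂ + B₁ * V₁ * Q₁ * B₂ * C₂ * W₂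
     + B₁ * V₁ * Q₁ * (AG Q₂ B₂ C₂ W₂ T₂) * T₂ + B₁ * V₁ * Q₁ * (AG Q₂ B₂ C₂ W₂ T₂) * W₂ + (AG Q₁ A₁ B₁ V₁ T₁) * T₁ * T₂ * T₂ * B₂
     + (AG Q₁ A₁ B₁ V₁ T₁) * T₁ * T₂ * B₂ * B₂ + (AG Q₁ A₁ B₁ V₁ T₁) * T₁ * T₂ * B₂ * C₂ + 2 * (AG Q₁ A₁ B₁ V₁ T₁) * T₁ * T₂ * B₂ * W₂
     + (AG Q₁ A₁ B₁ V₁ T₁) * T₁ * T₂ * B₂ * Q₂ + (AG Q₁ A₁ B₁ V₁ T₁) * T₁ * B₂ * B₂ * W₂ + (AG Q₁ A₁ B₁ V₁ T₁) * T₁ * B₂ * C₂ * W₂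
     + (AG Q₁ A₁ B₁ V₁ T₁) * T₁ * B₂ * W₂ * W₂ + (AG Q₁ A₁ B₁ V₁ T₁) * T₁ * B₂ * W₂ * Q₂ + (AG Q₁ A₁ B₁ V₁ T₁) * B₁ * T₂ * T₂ * B₂
     + (AG Q₁ A₁ B₁ V₁ T₁) * B₁ * T₂ * B₂ * B₂ + (AG Q₁ A₁ B₁ V₁ T₁) * B₁ * T₂ * B₂ * C₂ + (AG Q₁ A₁ B₁ V₁ T₁) * B₁ * T₂ * B₂ * W₂
     + (AG Q₁ A₁ B₁ V₁ T₁) * B₁ * T₂ * B₂ * Q₂ + (AG Q₁ A₁ B₁ V₁ T₁) * V₁ * T₂ * T₂ * B₂ + (AG Q₁ A₁ B₁ V₁ T₁) * V₁ * T₂ * B₂ * B₂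
     + (AG Q₁ A₁ B₁ V₁ T₁) * V₁ * T₂ * B₂ * C₂ + 2 * (AG Q₁ A₁ B₁ V₁ T₁) * V₁ * T₂ * B₂ * W₂ + (AG Q₁ A₁ B₁ V₁ T₁) * V₁ * T₂ * B₂ * Q₂
     + (AG Q₁ A₁ B₁ V₁ T₁) * V₁ * B₂ * B₂ * W₂ + (AG Q₁ A₁ B₁ V₁ T₁) * V₁ * B₂ * C₂ * W₂ + (AG Q₁ A₁ B₁ V₁ T₁) * V₁ * B₂ * W₂ * W₂
     + (AG Q₁ A₁ B₁ V₁ T₁) * V₁ * B₂ * W₂ * Q₂ + (Ha Q₁ A₁ B₁ V₁ T₁) * T₂ * B₂ * B₂ + (Ha Q₁ A₁ B₁ V₁ T₁) * B₂ * B₂ * B₂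
     + (Ha Q₁ A₁ B₁ V₁ T₁) * B₂ * B₂ * C₂ + (Ha Q₁ A₁ B₁ V₁ T₁) * B₂ * B₂ * W₂ + (Ha Q₁ A₁ B₁ V₁ T₁) * B₂ * B₂ * Q₂
     + (((T₁ + V₁) * (T₂ + W₂) + T₁ * B₂ + B₁ * T₂) - (A₁ * C₂ + A₁ * Q₂ + B₁ * Q₂ + Q₁ * (B₂ + C₂ + Q₂))) * T₁ * B₁ * B₂ * W₂
     + (((T₁ + V₁) * (T₂ + W₂) + T₁ * B₂ + B₁ * T₂) - (A₁ * C₂ + A₁ * Q₂ + B₁ * Q₂ + Q₁ * (B₂ + C₂ + Q₂))) * T₁ * B₁ * (AG Q₂ B₂ C₂ W₂ T₂)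
     + (((T₁ + V₁) * (T₂ + W₂) + T₁ * B₂ + B₁ * T₂) - (A₁ * C₂ + A₁ * Q₂ + B₁ * Q₂ + Q₁ * (B₂ + C₂ + Q₂))) * B₁ * B₁ * (AG Q₂ B₂ C₂ W₂ T₂)
     + (((T₁ + V₁) * (T₂ + W₂) + T₁ * B₂ + B₁ * T₂) - (A₁ * C₂ + A₁ * Q₂ + B₁ * Q₂ + Q₁ * (B₂ + C₂ + Q₂))) * B₁ * V₁ * T₂ * B₂
     + (((T₁ + V₁) * (T₂ + W₂) + T₁ * B₂ + B₁ * T₂) - (A₁ * C₂ + A₁ * Q₂ + B₁ * Q₂ + Q₁ * (B₂ + C₂ + Q₂))) * B₁ * V₁ * B₂ * W₂ := by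
  simp only [Ha, Hb, AG]; ring

/-- Sign form of `Ha_twoSum_dense_sparse`: for nonnegative cells, `AG₁, AG₂ ≥ 0`, `Ha₁ ≥ 0`, `Hb₂ ≥ 0` and the output regime dense (`t_N ≥ q_N`), `0 ≤ Ha(N)`. [this work] -/
theorem Ha_twoSum_dense_sparse_nonneg {T₁ A₁ B₁ V₁ Q₁ T₂ B₂ C₂ W₂ Q₂ : ℝ}
    (hT₁ : 0 ≤ T₁) (hA₁ : 0 ≤ A₁) (hB₁ : 0 ≤ B₁) (hV₁ : 0 ≤ V₁) (hQ₁ : 0 ≤ Q₁)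
    (hT₂ : 0 ≤ T₂) (hB₂ : 0 ≤ B₂) (hC₂ : 0 ≤ C₂) (hW₂ : 0 ≤ W₂) (hQ₂ : 0 ≤ Q₂)
    (hAG₁ : 0 ≤ AG Q₁ A₁ B₁ V₁ T₁) (hAG₂ : 0 ≤ AG Q₂ B₂ C₂ W₂ T₂)
    (hH₁ : 0 ≤ Ha Q₁ A₁ B₁ V₁ T₁) (hH₂ : 0 ≤ Hb Q₂ B₂ C₂ W₂ T₂)
    (hN : (A₁ * C₂ + A₁ * Q₂ + B₁ * Q₂ + Q₁ * (B₂ + C₂ + Q₂)) ≤ ((T₁ + V₁) * (T₂ + W₂) + T₁ * B₂ + B₁ * T₂)) :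
    0 ≤ Ha (A₁ * C₂ + A₁ * Q₂ + B₁ * Q₂ + Q₁ * (B₂ + C₂ + Q₂))
      (T₁ * C₂ + T₁ * Q₂ + V₁ * (B₂ + C₂ + Q₂) + B₁ * C₂) (B₁ * B₂)
      (A₁ * (T₂ + W₂ + B₂) + B₁ * W₂ + Q₁ * (T₂ + W₂)) ((T₁ + V₁) * (T₂ + W₂) + T₁ * B₂ + B₁ * T₂) := by
  rw [Ha_twoSum_dense_sparse]
  have hr : 0 ≤ ((T₁ + V₁) * (T₂ + W₂) + T₁ * B₂ + B₁ * T₂) - (A₁ * C₂ + A₁ * Q₂ + B₁ * Q₂ + Q₁ * (B₂ + C₂ + Q₂)) := sub_nonneg.2 hN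
  generalize ((T₁ + V₁) * (T₂ + W₂) + T₁ * B₂ + B₁ * T₂) - (A₁ * C₂ + A₁ * Q₂ + B₁ * Q₂ + Q₁ * (B₂ + C₂ + Q₂)) = r at hr ⊢
  generalize AG Q₁ A₁ B₁ V₁ T₁ = G₁ at hAG₁ ⊢
  generalize AG Q₂ B₂ C₂ W₂ T₂ = G₂ at hAG₂ ⊢
  generalize Ha Q₁ A₁ B₁ V₁ T₁ = K₁ at hH₁ ⊢
  generalize Hb Q₂ B₂ C₂ W₂ T₂ = K₂ at hH₂ ⊢
  positivity

/-! ### The bridged series composition is a 2-sum (law level) -/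

/-- **Reduction used in KCLUSTER-gen28 §6.**  Hanging the new edge `v–s` (weight `y`) inside `N₁` is the pendant move of the terminal `v`
of the `(a,b,v)`-law: `(T,A,B,V,Q) ↦ (yT, yA, yB, V + (1−y)T, Q + (1−y)(A+B))`; the 2-sum of the moved law with the `(b,c,s)`-law of `N₂`
is, cell by cell, the MIXTURE `(1−y)·(series law through b) + y·(2-sum of the original laws)` — i.e. exactly the law of the bridged
series composition `N₁(a,b) ∪_b N₂(b,c) + y·vw` (the segment `L₀ + y·δ` of `…CubicThreePointLocusStability` at `z = 0`).  Five ring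
identities (cells in the order `q, u₁ = ab|c, u₂ = ac|b, u₃ = bc|a, t`).  Correction to the remark in the 'Higher-order structure'
docstring of `…LocusStability`: the segment statement holds for channel laws in `I` (this file's theorem), not for merely AG-feasible
pseudo-laws (explicit counterexample pair in KCLUSTER-gen28 §6). [this work] -/
theorem twoSum_pendant_mixture (T₁ A₁ B₁ V₁ Q₁ T₂ B₂ C₂ W₂ Q₂ y : R) :
    ((y * A₁) * C₂ + (y * A₁) * Q₂ + (y * B₁) * Q₂ + (Q₁ + (1 - y) * (A₁ + B₁)) * (B₂ + C₂ + Q₂)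
        = (1 - y) * ((Q₁ + A₁ + B₁) * (B₂ + C₂ + Q₂)) + y * (A₁ * C₂ + A₁ * Q₂ + B₁ * Q₂ + Q₁ * (B₂ + C₂ + Q₂)))
    ∧ ((y * T₁) * C₂ + (y * T₁) * Q₂ + (V₁ + (1 - y) * T₁) * (B₂ + C₂ + Q₂) + (y * B₁) * C₂
        = (1 - y) * ((V₁ + T₁) * (B₂ + C₂ + Q₂)) + y * (T₁ * C₂ + T₁ * Q₂ + V₁ * (B₂ + C₂ + Q₂) + B₁ * C₂))
    ∧ ((y * B₁) * B₂ = (1 - y) * 0 + y * (B₁ * B₂))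
    ∧ ((y * A₁) * (T₂ + W₂ + B₂) + (y * B₁) * W₂ + (Q₁ + (1 - y) * (A₁ + B₁)) * (T₂ + W₂)
        = (1 - y) * ((Q₁ + A₁ + B₁) * (T₂ + W₂)) + y * (A₁ * (T₂ + W₂ + B₂) + B₁ * W₂ + Q₁ * (T₂ + W₂)))
    ∧ (((y * T₁) + (V₁ + (1 - y) * T₁)) * (T₂ + W₂) + (y * T₁) * B₂ + (y * B₁) * T₂
        = (1 - y) * ((T₁ + V₁) * (T₂ + W₂)) + y * ((T₁ + V₁) * (T₂ + W₂) + T₁ * B₂ + B₁ * T₂)) := by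
  refine ⟨by ring, by ring, by ring, by ring, by ring⟩

/-! ### The closure theorem -/

/-- On a law with `AG ≥ 0`, in the sparse regime the sparse sheet dominates: `T ≤ Q ⟹ Ha ≤ Hb` (`Hb − Ha = (Q − T)·AG`). [folklore] -/
theorem Ha_le_Hb_of_sparse {Q U₁ U₂ U₃ T : ℝ} (hAG : 0 ≤ AG Q U₁ U₂ U₃ T) (h : T ≤ Q) :
    Ha Q U₁ U₂ U₃ T ≤ Hb Q U₁ U₂ U₃ T := by
  have key : Hb Q U₁ U₂ U₃ T - Ha Q U₁ U₂ U₃ T = (Q - T) * AG Q U₁ U₂ U₃ T := by simp only [Hb, Ha, AG]; ring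
  nlinarith [mul_nonneg (sub_nonneg.2 h) hAG]

/-- Dually, in the dense regime `Q ≤ T ⟹ Hb ≤ Ha`. [folklore] -/
theorem Hb_le_Ha_of_dense {Q U₁ U₂ U₃ T : ℝ} (hAG : 0 ≤ AG Q U₁ U₂ U₃ T) (h : Q ≤ T) :
    Hb Q U₁ U₂ U₃ T ≤ Ha Q U₁ U₂ U₃ T := by
  have key : Ha Q U₁ U₂ U₃ T - Hb Q U₁ U₂ U₃ T = (T - Q) * AG Q U₁ U₂ U₃ T := by simp only [Hb, Ha, AG]; ring
  nlinarith [mul_nonneg (sub_nonneg.2 h) hAG]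

/-- **2-SUM CLOSURE THEOREM (law level).**  If the three-point laws of `(a,b,s)` in `N₁` and of `(b,c,s)` in `N₂` have nonnegative cells,
`AG ≥ 0` and `max(Ha,Hb) ≥ 0` (the K3 invariant `I`), then so does the law of `(a,b,c)` in the 2-sum `N₁ ∪_{b,s} N₂`:
`0 ≤ AG(N)` and `0 ≤ max(Ha(N), Hb(N))`.  (Cells of `N` are sums of products of cells, hence nonnegative.)  Proof: split each piece by its
regime (`le_total`), upgrade `max ≥ 0` to the dominating sheet (`Ha_le_Hb_of_sparse` / `Hb_le_Ha_of_dense`), and apply the four certified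
cases — same type: part I (`Hb_twoSum_sparse_nonneg`, `Ha_twoSum_dense_nonneg`); mixed type: this file, split by the output regime. [this work] -/
theorem maxH_twoSum_nonneg {T₁ A₁ B₁ V₁ Q₁ T₂ B₂ C₂ W₂ Q₂ : ℝ}
    (hT₁ : 0 ≤ T₁) (hA₁ : 0 ≤ A₁) (hB₁ : 0 ≤ B₁) (hV₁ : 0 ≤ V₁) (hQ₁ : 0 ≤ Q₁)
    (hT₂ : 0 ≤ T₂) (hB₂ : 0 ≤ B₂) (hC₂ : 0 ≤ C₂) (hW₂ : 0 ≤ W₂) (hQ₂ : 0 ≤ Q₂)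
    (hAG₁ : 0 ≤ AG Q₁ A₁ B₁ V₁ T₁) (hAG₂ : 0 ≤ AG Q₂ B₂ C₂ W₂ T₂)
    (h₁ : 0 ≤ max (Ha Q₁ A₁ B₁ V₁ T₁) (Hb Q₁ A₁ B₁ V₁ T₁)) (h₂ : 0 ≤ max (Ha Q₂ B₂ C₂ W₂ T₂) (Hb Q₂ B₂ C₂ W₂ T₂)) :
    0 ≤ AG (A₁ * C₂ + A₁ * Q₂ + B₁ * Q₂ + Q₁ * (B₂ + C₂ + Q₂))
      (T₁ * C₂ + T₁ * Q₂ + V₁ * (B₂ + C₂ + Q₂) + B₁ * C₂) (B₁ * B₂)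
      (A₁ * (T₂ + W₂ + B₂) + B₁ * W₂ + Q₁ * (T₂ + W₂)) ((T₁ + V₁) * (T₂ + W₂) + T₁ * B₂ + B₁ * T₂)
    ∧ 0 ≤ max (Ha (A₁ * C₂ + A₁ * Q₂ + B₁ * Q₂ + Q₁ * (B₂ + C₂ + Q₂))
      (T₁ * C₂ + T₁ * Q₂ + V₁ * (B₂ + C₂ + Q₂) + B₁ * C₂) (B₁ * B₂)
      (A₁ * (T₂ + W₂ + B₂) + B₁ * W₂ + Q₁ * (T₂ + W₂)) ((T₁ + V₁) * (T₂ + W₂) + T₁ * B₂ + B₁ * T₂))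
      (Hb (A₁ * C₂ + A₁ * Q₂ + B₁ * Q₂ + Q₁ * (B₂ + C₂ + Q₂))
      (T₁ * C₂ + T₁ * Q₂ + V₁ * (B₂ + C₂ + Q₂) + B₁ * C₂) (B₁ * B₂)
      (A₁ * (T₂ + W₂ + B₂) + B₁ * W₂ + Q₁ * (T₂ + W₂)) ((T₁ + V₁) * (T₂ + W₂) + T₁ * B₂ + B₁ * T₂)) := by
  refine ⟨AG_twoSum_nonneg hT₁ hA₁ hB₁ hV₁ hQ₁ hT₂ hB₂ hC₂ hW₂ hQ₂ hAG₁ hAG₂, ?_⟩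
  rcases le_total T₁ Q₁ with hs₁ | hd₁ <;> rcases le_total T₂ Q₂ with hs₂ | hd₂
  · -- sparse × sparse
    have k₁ : 0 ≤ Hb Q₁ A₁ B₁ V₁ T₁ := le_trans h₁ (max_le (Ha_le_Hb_of_sparse hAG₁ hs₁) le_rfl)
    have k₂ : 0 ≤ Hb Q₂ B₂ C₂ W₂ T₂ := le_trans h₂ (max_le (Ha_le_Hb_of_sparse hAG₂ hs₂) le_rfl)
    exact le_max_of_le_right (Hb_twoSum_sparse_nonneg hT₁ hA₁ hB₁ hV₁ hQ₁ hT₂ hB₂ hC₂ hW₂ hQ₂ hAG₁ hAG₂ k₁ k₂ hs₁ hs₂)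
  · -- sparse × dense
    have k₁ : 0 ≤ Hb Q₁ A₁ B₁ V₁ T₁ := le_trans h₁ (max_le (Ha_le_Hb_of_sparse hAG₁ hs₁) le_rfl)
    have k₂ : 0 ≤ Ha Q₂ B₂ C₂ W₂ T₂ := le_trans h₂ (max_le le_rfl (Hb_le_Ha_of_dense hAG₂ hd₂))
    rcases le_total ((T₁ + V₁) * (T₂ + W₂) + T₁ * B₂ + B₁ * T₂) (A₁ * C₂ + A₁ * Q₂ + B₁ * Q₂ + Q₁ * (B₂ + C₂ + Q₂)) with hN | hN
    · exact le_max_of_le_right (Hb_twoSum_sparse_dense_nonneg hT₁ hA₁ hB₁ hV₁ hQ₁ hT₂ hB₂ hC₂ hW₂ hQ₂ hAG₁ hAG₂ k₁ k₂ hN)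
    · exact le_max_of_le_left (Ha_twoSum_sparse_dense_nonneg hT₁ hA₁ hB₁ hV₁ hQ₁ hT₂ hB₂ hC₂ hW₂ hQ₂ hAG₁ hAG₂ k₁ k₂ hN)
  · -- dense × sparse
    have k₁ : 0 ≤ Ha Q₁ A₁ B₁ V₁ T₁ := le_trans h₁ (max_le le_rfl (Hb_le_Ha_of_dense hAG₁ hd₁))
    have k₂ : 0 ≤ Hb Q₂ B₂ C₂ W₂ T₂ := le_trans h₂ (max_le (Ha_le_Hb_of_sparse hAG₂ hs₂) le_rfl)
    rcases le_total ((T₁ + V₁) * (T₂ + W₂) + T₁ * B₂ + B₁ * T₂) (A₁ * C₂ + A₁ * Q₂ + B₁ * Q₂ + Q₁ * (B₂ + C₂ + Q₂)) with hN | hN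
    · exact le_max_of_le_right (Hb_twoSum_dense_sparse_nonneg hT₁ hA₁ hB₁ hV₁ hQ₁ hT₂ hB₂ hC₂ hW₂ hQ₂ hAG₁ hAG₂ k₁ k₂ hN)
    · exact le_max_of_le_left (Ha_twoSum_dense_sparse_nonneg hT₁ hA₁ hB₁ hV₁ hQ₁ hT₂ hB₂ hC₂ hW₂ hQ₂ hAG₁ hAG₂ k₁ k₂ hN)
  · -- dense × dense
    have k₁ : 0 ≤ Ha Q₁ A₁ B₁ V₁ T₁ := le_trans h₁ (max_le le_rfl (Hb_le_Ha_of_dense hAG₁ hd₁))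
    have k₂ : 0 ≤ Ha Q₂ B₂ C₂ W₂ T₂ := le_trans h₂ (max_le le_rfl (Hb_le_Ha_of_dense hAG₂ hd₂))
    exact le_max_of_le_left (Ha_twoSum_dense_nonneg hT₁ hA₁ hB₁ hV₁ hQ₁ hT₂ hB₂ hC₂ hW₂ hQ₂ hAG₁ hAG₂ k₁ k₂ hd₁ hd₂)

end CubicThreePointTwoSum

end Summit.CriticalPhenomena.PercolationContinuityZ3.Theorems
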